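import Mathlib
import Summits.NavierStokesRegularity.NavierStokesRegularity.Theorems.EulerZoomLiouvillePowerGaugeEulerLiouvilleModulatedEulerBrackets
import Summits.NavierStokesRegularity.NavierStokesRegularity.Theorems.EulerZoomLiouvillePowerGaugeEulerLiouvilleSeparableEulerPast
import Summits.NavierStokesRegularity.NavierStokesRegularity.Theorems.EulerZoomLiouvillePowerGaugeEulerLiouvilleSupercriticalModulationPast
import HarnessLib

/-!
# Crux `EulerZoomLiouville.PowerGaugeEulerLiouville` (stmt-NavierStokesRegularity-19832), stub `stub_nonSelfSimilarRest`:
# a steady field plus ONE `C¹`-modulated pattern is trivial UNLESS the modulation solves a constant-coefficient RICCATI equation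

Helper file (theorems only; `--supports stmt-NavierStokesRegularity-19832`; def-free).  Hand leafhand-ns-eulerzoomliouville-11 g0;
member theorem for the tools `…ModulatedEulerBrackets` (the pattern lane's analogue of `…SeparableEulerPast`).

THE STRATUM.  A member `(u, p, H, c)` (`ρ > 0`) with `u(τ, x) = U₀(x) + θ(τ) U₁(x)` for a.e. `(τ, x) ∈ (−∞,T₁) × ℝ³` (`T₁ ≤ 0`; `U₀, U₁`
ARBITRARY; `θ ∈ C¹(ℝ)`) such that `θ` does NOT satisfy `θ' = α + βθ + γθ²` on `(−∞,T₁)` for any constants `α, β, γ` vanishes a.e. on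
the slab (`ModulatedEuler.ae_eq_zero_of_gauge_of_aeModulatedEuler`, binder `Birth.nonSelfSimilar_of_aeModulatedEuler`).  Together with
this hand's gauge files the residual of the lane `U₀ + θU₁` is: `θ` an EVANESCENT Riccati solution (`e^{βt} → 0`-type, `tanh`-type,
`1/(T−t)`), the growing / oscillating / constant / affine Riccati solutions being already closed.

PROOF.  `θ` is not constant on the past (Riccati with `α = β = γ = 0` excluded), so by continuity and density of good slices there are
good `τa, τb` with `θ(τa) ≠ θ(τb)`: then `U₁ = (θ(τb) − θ(τa))⁻¹ (u(τb) − u(τa))`, `U₀ = u(τa) − θ(τa)U₁` are in `L¹_loc ∩ L²_loc`, and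
the two-slice `A`-gauge estimate of `…AffineTimePast` gives the sub-volume growth `∫_{B_r}|U₁|² ≤ K r^{1−2ρ}`.  The a.e.-modified field
with literal slices is again an Euler pair; by `…ModulatedEulerBrackets` (no Riccati) `U₁` is weakly orthogonal to curl pairs and
weakly divergence free, hence weakly harmonic coordinatewise (tree `integral_laplacian_mul_inner_eq_zero_of_curlPair`), hence `U₁ = 0`
a.e. (tree `ae_eq_zero_of_weaklyHarmonic_of_growth`); so `u = U₀` a.e. on the past slab and `AePastSteady` concludes.

WHAT THIS IS NOT: not a proof of the stub or of the crux; nothing about Navier–Stokes. [folklore]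
-/

noncomputable section

-- flat `Theorems/<Route><Decl>…` files of one crux share the namespace of the crux (tree convention)
set_option linter.dupNamespace false

open MeasureTheory Set Filter Topology Metric Function TopologicalSpace
open scoped RealInnerProductSpace NNReal ENNReal ContDiff Laplacian

namespace Summit.NavierStokesRegularity.NavierStokesRegularity.Theorems.PowerGaugeEulerLiouville

open Literature.Analysis Literature.Analysis.FunctionSpaces Literature.Analysis.FluidPDE

namespace ModulatedEuler

/-- A slice of a member bounded by the `A`-gauge on all large balls is locally square integrable. [folklore] -/
theorem locallyIntegrable_sq_of_ballBound {f : EuclideanSpace ℝ (Fin 3) → EuclideanSpace ℝ (Fin 3)}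
    (hfm : AEStronglyMeasurable f volume) {r₀ : ℝ} {B : ℝ → ℝ≥0∞} (hB : ∀ a, r₀ < a → 0 < a → B a < ⊤)
    (hball : ∀ a : ℝ, r₀ < a → 0 < a → ∫⁻ x in ball (0 : EuclideanSpace ℝ (Fin 3)) a, ‖f x‖ₑ ^ 2 ≤ B a) :
    LocallyIntegrable (fun y => ‖f y‖ ^ 2) volume := by
  refine locallyIntegrableOn_univ.1 ((locallyIntegrableOn_iff isClosed_univ.isLocallyClosed).2 fun K _ hK => ?_)
  obtain ⟨R, hR⟩ := hK.isBounded.subset_ball 0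
  set a : ℝ := max (max R r₀) 0 + 1 with ha
  have haR : R < a := by have := le_max_left R r₀; have := le_max_left (max R r₀) 0; linarith
  have har : r₀ < a := by have := le_max_right R r₀; have := le_max_left (max R r₀) 0; linarith
  have ha0 : 0 < a := by have := le_max_right (max R r₀) 0; linarith
  refine IntegrableOn.mono_set ?_ (hR.trans (ball_subset_ball haR.le))
  refine ⟨(hfm.norm.pow 2).restrict, ?_⟩
  have hfin := (hball a har ha0).trans_lt (hB a har ha0)
  refine lt_of_le_of_lt (lintegral_mono fun x => le_of_eq ?_) hfin
  rw [Real.enorm_eq_ofReal (sq_nonneg _), ← ofReal_norm, ENNReal.ofReal_pow (norm_nonneg _)]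

/-- **STEADY FIELD + ONE `C¹`-MODULATED PATTERN OFF THE RICCATI FAMILY ⇒ TRIVIAL.**  Let `(u, p)` be a suitable weak Euler pair on
`(−∞,0) × ℝ³` with weak spatial gradient `H` and gauges `a^{2ρ} A(a) + a^{ρ} E(a) + a^{2ρ} D(a) ≤ c` (`ρ > 0`); suppose
`u(τ, x) = U₀(x) + θ(τ) U₁(x)` for a.e. `(τ, x) ∈ (−∞,T₁) × ℝ³` (`T₁ ≤ 0`, `U₀ U₁` arbitrary, `θ ∈ C¹`) and that `θ` does not solve
`θ' = α + βθ + γθ²` on `(−∞,T₁)` for any `α β γ ∈ ℝ`.  Then `u = 0` a.e. on the slab. [folklore] -/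
theorem ae_eq_zero_of_gauge_of_aeModulatedEuler {ρ : ℝ} (hρ : 0 < ρ)
    {u : ℝ → EuclideanSpace ℝ (Fin 3) → EuclideanSpace ℝ (Fin 3)} {p : ℝ → EuclideanSpace ℝ (Fin 3) → ℝ}
    {H : ℝ → EuclideanSpace ℝ (Fin 3) → EuclideanSpace ℝ (Fin 3) →L[ℝ] EuclideanSpace ℝ (Fin 3)} {c : ℝ≥0}
    (hsw : IsSuitableWeakSolutionOn (slab (EuclideanSpace ℝ (Fin 3)) (Iio 0) isOpen_Iio) 0 0 u p)
    (hH : HasWeakSpatialGradientOn (slab (EuclideanSpace ℝ (Fin 3)) (Iio 0) isOpen_Iio) u H)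
    (hc : ∀ a : ℝ, 0 < a → ENNReal.ofReal (a ^ (2 * ρ)) * cknA a (0 : ℝ × EuclideanSpace ℝ (Fin 3)) u +
        ENNReal.ofReal (a ^ ρ) * cknE a (0 : ℝ × EuclideanSpace ℝ (Fin 3)) H +
        ENNReal.ofReal (a ^ (2 * ρ)) * cknD a (0 : ℝ × EuclideanSpace ℝ (Fin 3)) p ≤ (c : ℝ≥0∞))
    {T₁ : ℝ} (hT₁ : T₁ ≤ 0) {θ : ℝ → ℝ} (hθ1 : ContDiff ℝ 1 θ)
    (hric : ¬ ∃ α β γ : ℝ, ∀ t, t < T₁ → deriv θ t = α + β * θ t + γ * θ t ^ 2)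
    {U₀ U₁ : EuclideanSpace ℝ (Fin 3) → EuclideanSpace ℝ (Fin 3)}
    (hU : ∀ᵐ z ∂(volume.restrict (Iio T₁ ×ˢ (univ : Set (EuclideanSpace ℝ (Fin 3))))),
      u z.1 z.2 = U₀ z.2 + θ z.1 • U₁ z.2) :
    uncurry u =ᵐ[volume.restrict (Iio (0 : ℝ) ×ˢ (univ : Set (EuclideanSpace ℝ (Fin 3))))] 0 := by
  classical
  have hθc : Continuous θ := hθ1.continuous
  have hA : ∀ a : ℝ, 0 < a →
      ENNReal.ofReal (a ^ (2 * ρ)) * cknA a (0 : ℝ × EuclideanSpace ℝ (Fin 3)) u ≤ (c : ℝ≥0∞) :=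
    fun a ha => le_trans (le_add_right (le_add_right le_rfl)) (hc a ha)
  -- ## (1) good slices; two good slices with different modulation values
  have hgood : ∀ᵐ τ ∂(volume.restrict (Iio T₁)),
      LocallyIntegrable (u τ) volume ∧ ∀ᵐ x ∂(volume : Measure (EuclideanSpace ℝ (Fin 3))), u τ x = U₀ x + θ τ • U₁ x := by
    filter_upwards [FrameSteady.ae_hasWeakFDerivOn_slice_past hH hT₁,
      AffinePast.ae_ae_of_ae_slab (P := fun τ x => u τ x = U₀ x + θ τ • U₁ x) hU] with τ hτ hτ'
    exact ⟨locallyIntegrableOn_univ.1 (by simpa only [Opens.coe_top] using hτ.locallyIntegrableOn), hτ'⟩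
  obtain ⟨ta, tb, hta, htb, htab⟩ : ∃ ta tb, ta < T₁ ∧ tb < T₁ ∧ θ ta ≠ θ tb := by
    by_contra hne
    push Not at hne
    apply hric
    refine ⟨0, 0, 0, fun t ht => ?_⟩
    have hev : θ =ᶠ[𝓝 t] fun _ => θ t := by
      filter_upwards [Iio_mem_nhds ht] with s hs
      exact hne s t hs ht
    rw [hev.deriv_eq, deriv_const]
    ring
  -- good slices near `ta`, `tb` keep distinct values
  have hpick : ∀ t₀, t₀ < T₁ → ∀ ε > 0, ∃ τ, τ < T₁ ∧ |θ τ - θ t₀| < ε ∧ (LocallyIntegrable (u τ) volume ∧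
      ∀ᵐ x ∂(volume : Measure (EuclideanSpace ℝ (Fin 3))), u τ x = U₀ x + θ τ • U₁ x) := by
    intro t₀ ht₀ ε hε
    have hev : ∀ᶠ s in 𝓝 t₀, |θ s - θ t₀| < ε ∧ s < T₁ := by
      refine (Filter.Eventually.and ?_ (Iio_mem_nhds ht₀))
      have h := Metric.tendsto_nhds.1 (hθc.tendsto t₀) ε hε
      filter_upwards [h] with s hs
      rwa [Real.dist_eq] at hs
    obtain ⟨δ, hδ, hball⟩ := Metric.mem_nhds_iff.1 hev
    have hwin : volume (ball t₀ δ) ≠ 0 := (measure_ball_pos volume t₀ hδ).ne'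
    have hsub : ball t₀ δ ⊆ Iio T₁ := fun s hs => (hball hs).2
    obtain ⟨τ, hτ, hg⟩ := Measure.exists_mem_of_measure_ne_zero_of_ae hwin (ae_restrict_of_ae_restrict_of_subset hsub hgood)
    exact ⟨τ, (hball hτ).2, (hball hτ).1, hg⟩
  set d : ℝ := |θ ta - θ tb| with hd
  have hdpos : 0 < d := abs_pos.2 (sub_ne_zero.2 htab)
  obtain ⟨τa, hτaT, hτa_near, hgooda⟩ := hpick ta hta (d / 3) (by positivity)
  obtain ⟨τb, hτbT, hτb_near, hgoodb⟩ := hpick tb htb (d / 3) (by positivity)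
  have hab : θ τb - θ τa ≠ 0 := by
    intro h0
    have h1 : |θ ta - θ tb| ≤ |θ τa - θ ta| + |θ τb - θ tb| := by
      have e : θ ta - θ tb = (θ τb - θ tb) - (θ τa - θ ta) := by linarith
      rw [e]
      exact (abs_sub _ _).trans (by rw [add_comm])
    linarith
  have hτa0 : τa < 0 := lt_of_lt_of_le hτaT hT₁
  have hτb0 : τb < 0 := lt_of_lt_of_le hτbT hT₁
  -- ## (2) `U₁`, `U₀` locally integrable and locally square integrable; growth of `U₁`
  have hmA : AEStronglyMeasurable (fun x => U₀ x + θ τa • U₁ x) volume := hgooda.1.aestronglyMeasurable.congr hgooda.2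
  have hmB : AEStronglyMeasurable (fun x => U₀ x + θ τb • U₁ x) volume := hgoodb.1.aestronglyMeasurable.congr hgoodb.2
  have eU₁ : U₁ = (θ τb - θ τa)⁻¹ • ((fun x => U₀ x + θ τb • U₁ x) - fun x => U₀ x + θ τa • U₁ x) := by
    funext x
    simp only [Pi.smul_apply, Pi.sub_apply]
    rw [add_sub_add_left_eq_sub, ← sub_smul, smul_smul, inv_mul_cancel₀ hab, one_smul]
  have hlA : LocallyIntegrable (fun x => U₀ x + θ τa • U₁ x) volume :=
    locallyIntegrableOn_univ.1 ((locallyIntegrableOn_univ.2 hgooda.1).congr (by rw [Measure.restrict_univ]; exact hgooda.2))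
  have hlB : LocallyIntegrable (fun x => U₀ x + θ τb • U₁ x) volume :=
    locallyIntegrableOn_univ.1 ((locallyIntegrableOn_univ.2 hgoodb.1).congr (by rw [Measure.restrict_univ]; exact hgoodb.2))
  have hU₁l : LocallyIntegrable U₁ volume := by rw [eU₁]; exact (hlB.sub hlA).smul _
  have eU₀ : U₀ = (fun x => U₀ x + θ τa • U₁ x) - θ τa • U₁ := by
    funext x; simp only [Pi.sub_apply, Pi.smul_apply]; abel
  have hU₀l : LocallyIntegrable U₀ volume := by rw [eU₀]; exact hlA.sub (hU₁l.smul _)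
  have hU₁m : AEStronglyMeasurable U₁ volume := hU₁l.aestronglyMeasurable
  -- square integrability of the two good slices
  have hsqslice : ∀ τ, τ < 0 → (LocallyIntegrable (u τ) volume ∧
      ∀ᵐ x ∂(volume : Measure (EuclideanSpace ℝ (Fin 3))), u τ x = U₀ x + θ τ • U₁ x) →
      LocallyIntegrable (fun y => ‖U₀ y + θ τ • U₁ y‖ ^ 2) volume := by
    intro τ hτ0 hg
    refine locallyIntegrable_sq_of_ballBound (hg.1.aestronglyMeasurable.congr hg.2) (r₀ := Real.sqrt (-τ))
      (B := fun a => ENNReal.ofReal ((c : ℝ) * a ^ (1 - 2 * ρ))) (fun a _ _ => ENNReal.ofReal_lt_top) fun a ha ha0 => ?_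
    have hτa : τ ∈ Ioo (-(a ^ 2)) 0 := by
      refine ⟨?_, hτ0⟩
      have h1 : Real.sqrt (-τ) ^ 2 = -τ := Real.sq_sqrt (by linarith)
      have h3 : Real.sqrt (-τ) ^ 2 < a ^ 2 := pow_lt_pow_left₀ ha (Real.sqrt_nonneg _) two_ne_zero
      linarith
    refine le_of_eq_of_le ?_ (Backward.lintegral_ball_le_of_gaugeA ha0 (hA a ha0) hτa)
    refine lintegral_congr_ae (ae_restrict_of_ae ?_)
    filter_upwards [hg.2] with x hx
    rw [hx]
  have hsqA := hsqslice τa hτa0 hgooda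
  have hsqB := hsqslice τb hτb0 hgoodb
  have hU₁2 : LocallyIntegrable (fun y => ‖U₁ y‖ ^ 2) volume := by
    have hdom : LocallyIntegrable (fun y => 2 * (θ τb - θ τa)⁻¹ ^ 2 * ‖U₀ y + θ τb • U₁ y‖ ^ 2 +
        2 * (θ τb - θ τa)⁻¹ ^ 2 * ‖U₀ y + θ τa • U₁ y‖ ^ 2) volume :=
      (hsqB.smul (2 * (θ τb - θ τa)⁻¹ ^ 2)).add (hsqA.smul (2 * (θ τb - θ τa)⁻¹ ^ 2))
    refine hdom.mono (hU₁m.norm.pow 2) (Eventually.of_forall fun y => ?_)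
    rw [Real.norm_of_nonneg (sq_nonneg _), Real.norm_of_nonneg (by positivity)]
    have e : U₁ y = (θ τb - θ τa)⁻¹ • ((U₀ y + θ τb • U₁ y) - (U₀ y + θ τa • U₁ y)) := by
      rw [add_sub_add_left_eq_sub, ← sub_smul, smul_smul, inv_mul_cancel₀ hab, one_smul]
    have h1 : ‖U₁ y‖ ≤ |(θ τb - θ τa)⁻¹| * (‖U₀ y + θ τb • U₁ y‖ + ‖U₀ y + θ τa • U₁ y‖) := by
      conv_lhs => rw [e]
      rw [norm_smul, Real.norm_eq_abs]
      exact mul_le_mul_of_nonneg_left (norm_sub_le _ _) (abs_nonneg _)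
    have h2 : 0 ≤ |(θ τb - θ τa)⁻¹| := abs_nonneg _
    calc ‖U₁ y‖ ^ 2 ≤ (|(θ τb - θ τa)⁻¹| * (‖U₀ y + θ τb • U₁ y‖ + ‖U₀ y + θ τa • U₁ y‖)) ^ 2 :=
          pow_le_pow_left₀ (norm_nonneg _) h1 2
      _ ≤ 2 * (θ τb - θ τa)⁻¹ ^ 2 * ‖U₀ y + θ τb • U₁ y‖ ^ 2 + 2 * (θ τb - θ τa)⁻¹ ^ 2 * ‖U₀ y + θ τa • U₁ y‖ ^ 2 := by
          rw [mul_pow, sq_abs]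
          nlinarith [sq_nonneg (‖U₀ y + θ τb • U₁ y‖ - ‖U₀ y + θ τa • U₁ y‖), sq_nonneg ((θ τb - θ τa)⁻¹)]
  have hU₀2 : LocallyIntegrable (fun y => ‖U₀ y‖ ^ 2) volume := by
    have hdom : LocallyIntegrable (fun y => 2 * ‖U₀ y + θ τa • U₁ y‖ ^ 2 + 2 * θ τa ^ 2 * ‖U₁ y‖ ^ 2) volume :=
      (hsqA.smul (2 : ℝ)).add (hU₁2.smul (2 * θ τa ^ 2))
    refine hdom.mono (hU₀l.aestronglyMeasurable.norm.pow 2) (Eventually.of_forall fun y => ?_)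
    rw [Real.norm_of_nonneg (sq_nonneg _), Real.norm_of_nonneg (by positivity)]
    have h1 : ‖U₀ y‖ ≤ ‖U₀ y + θ τa • U₁ y‖ + |θ τa| * ‖U₁ y‖ := by
      have h := norm_sub_le (U₀ y + θ τa • U₁ y) (θ τa • U₁ y)
      rw [add_sub_cancel_right, norm_smul, Real.norm_eq_abs] at h
      exact h
    nlinarith [sq_nonneg (‖U₀ y + θ τa • U₁ y‖ - |θ τa| * ‖U₁ y‖), norm_nonneg (U₀ y), abs_nonneg (θ τa),
      norm_nonneg (U₁ y), norm_nonneg (U₀ y + θ τa • U₁ y), sq_abs (θ τa)]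
  -- growth of `U₁` from the two-slice estimate
  set r₀ : ℝ := Real.sqrt (-τa) + Real.sqrt (-τb) with hr₀
  have hgrowth : ∀ r : ℝ, r₀ < r → 0 < r →
      ∫⁻ x in ball (0 : EuclideanSpace ℝ (Fin 3)) r, ‖U₁ x‖ₑ ^ 2 ≤
        ENNReal.ofReal (4 * ((c : ℝ) * r ^ (1 - 2 * ρ)) / (θ τb - θ τa) ^ 2) := by
    intro r hr hr0
    have hwin : ∀ σ : ℝ, σ < 0 → Real.sqrt (-σ) < r → σ ∈ Ioo (-(r ^ 2)) 0 := by
      intro σ hσ hσr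
      refine ⟨?_, hσ⟩
      have h1 : Real.sqrt (-σ) ^ 2 = -σ := Real.sq_sqrt (by linarith)
      have h3 : Real.sqrt (-σ) ^ 2 < r ^ 2 := pow_lt_pow_left₀ hσr (Real.sqrt_nonneg _) two_ne_zero
      linarith
    have hsa : 0 ≤ Real.sqrt (-τa) := Real.sqrt_nonneg _
    have hsb : 0 ≤ Real.sqrt (-τb) := Real.sqrt_nonneg _
    have hb₁ : ∫⁻ x in ball (0 : EuclideanSpace ℝ (Fin 3)) r, ‖U₀ x + θ τa • U₁ x‖ₑ ^ 2 ≤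
        ENNReal.ofReal ((c : ℝ) * r ^ (1 - 2 * ρ)) := by
      refine le_of_eq_of_le ?_ (Backward.lintegral_ball_le_of_gaugeA hr0 (hA r hr0) (hwin τa hτa0 (by linarith)))
      refine lintegral_congr_ae (ae_restrict_of_ae ?_)
      filter_upwards [hgooda.2] with x hx
      rw [hx]
    have hb₂ : ∫⁻ x in ball (0 : EuclideanSpace ℝ (Fin 3)) r, ‖U₀ x + θ τb • U₁ x‖ₑ ^ 2 ≤
        ENNReal.ofReal ((c : ℝ) * r ^ (1 - 2 * ρ)) := by
      refine le_of_eq_of_le ?_ (Backward.lintegral_ball_le_of_gaugeA hr0 (hA r hr0) (hwin τb hτb0 (by linarith)))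
      refine lintegral_congr_ae (ae_restrict_of_ae ?_)
      filter_upwards [hgoodb.2] with x hx
      rw [hx]
    have hkey := AffinePast.lintegral_coeff_le_of_two_slices
      (μ := volume.restrict (ball (0 : EuclideanSpace ℝ (Fin 3)) r)) hmB.restrict hb₁ hb₂
    have hY : 0 < (θ τb - θ τa) ^ 2 := by positivity
    have hXY : ENNReal.ofReal ((θ τb - θ τa) ^ 2) ≤ ‖θ τb - θ τa‖ₑ ^ 2 := by
      rw [Real.enorm_eq_ofReal_abs, ← ENNReal.ofReal_pow (abs_nonneg _), sq_abs]
    exact ModulatedPast.lintegral_le_of_gap hY hXY hkey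
  -- ## (3) the a.e.-modified field with literal slices
  set v : ℝ → EuclideanSpace ℝ (Fin 3) → EuclideanSpace ℝ (Fin 3) :=
    fun τ x => if τ < T₁ then U₀ x + θ τ • U₁ x else u τ x with hvdef
  have hvu : ∀ᵐ z ∂(volume.restrict ((slab (EuclideanSpace ℝ (Fin 3)) (Iio 0) isOpen_Iio : Opens (ℝ × EuclideanSpace ℝ (Fin 3))) :
      Set (ℝ × EuclideanSpace ℝ (Fin 3)))), uncurry u z = uncurry v z := by
    rw [coe_slab]
    have h1 : ∀ᵐ z ∂(volume.restrict (Iio (0 : ℝ) ×ˢ (univ : Set (EuclideanSpace ℝ (Fin 3))))),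
        z ∈ Iio T₁ ×ˢ (univ : Set (EuclideanSpace ℝ (Fin 3))) → u z.1 z.2 = U₀ z.2 + θ z.1 • U₁ z.2 :=
      ae_restrict_of_ae (ae_imp_of_ae_restrict hU)
    filter_upwards [h1] with z hz
    by_cases ht : z.1 < T₁
    · simp only [uncurry, hvdef, if_pos ht]
      exact hz ⟨ht, mem_univ _⟩
    · simp only [uncurry, hvdef, if_neg ht]
  have hsol : IsDistributionalNSSolutionOn (slab (EuclideanSpace ℝ (Fin 3)) (Iio 0) isOpen_Iio) 0 0 v p :=
    (hsw.congr_ae hvu (Eventually.of_forall fun _ => rfl)).distributional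
  have hv : ∀ τ, τ < T₁ → v τ = fun x => U₀ x + θ τ • U₁ x := fun τ hτ => funext fun x => if_pos hτ
  -- ## (4) `U₁` is weakly curl free and weakly divergence free
  have hcurl : ∀ g : EuclideanSpace ℝ (Fin 3) → ℝ, IsTestFunctionOn (⊤ : Opens (EuclideanSpace ℝ (Fin 3))) g →
      ∀ a b : EuclideanSpace ℝ (Fin 3), ∫ x, ⟪U₁ x, fderiv ℝ g x a • b - fderiv ℝ g x b • a⟫ = 0 :=
    fun g hg a b => integral_inner_eq_zero_of_not_riccati hsol hT₁ hv hθ1 hric hU₀l hU₁l hU₀2 hU₁2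
      (isTestFunctionOn_curlPair hg a b) (SeparableEuler.divergence_curlPair_eq_zero' hg a b)
  have hdivU : IsWeaklyDivFree U₁ := isWeaklyDivFree_of_not_riccati hsol hT₁ hv hθ1 hric hU₀l hU₁l
  -- ## (5) every coordinate of `U₁` is weakly harmonic of sub-volume growth, hence `U₁ = 0` a.e.
  have hcoord : ∀ i : Fin 3, (fun x => ⟪U₁ x, EuclideanSpace.single i (1 : ℝ)⟫) =ᵐ[volume] 0 := by
    intro i
    set a : (EuclideanSpace ℝ (Fin 3)) := EuclideanSpace.single i (1 : ℝ) with ha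
    have ha1 : ‖a‖ = 1 := by rw [ha, PiLp.norm_single, norm_one]
    refine ae_eq_zero_of_weaklyHarmonic_of_growth (K := 4 * (c : ℝ) / (θ τb - θ τa) ^ 2) (m := 1 - 2 * ρ) (r₀ := r₀)
      ?_ ?_ (by linarith) ?_
    · have e1 : (fun x => ⟪U₁ x, a⟫) = fun x => (innerSL ℝ a) (U₁ x) := by
        funext x; simp only [innerSL_apply_apply, real_inner_comm]
      rw [e1, ← locallyIntegrableOn_univ]
      exact (innerSL ℝ a).locallyIntegrableOn_comp (locallyIntegrableOn_univ.2 hU₁l)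
    · intro φ hφ hφc
      have hθ : IsTestFunctionOn (⊤ : Opens (EuclideanSpace ℝ (Fin 3))) φ := ⟨hφ, hφc, by simp⟩
      have := integral_laplacian_mul_inner_eq_zero_of_curlPair hU₁l hdivU hcurl hθ a
      rw [← this]
      exact integral_congr_ae (Eventually.of_forall fun x => by simp only [mul_comm])
    · intro r hr hr0
      refine le_trans (lintegral_mono fun x => ?_) ((hgrowth r hr hr0).trans (le_of_eq ?_))
      · gcongr
        rw [← ofReal_norm, ← ofReal_norm]
        exact ENNReal.ofReal_le_ofReal ((norm_inner_le_norm _ _).trans (by rw [ha1, mul_one]))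
      · congr 1; ring
  have hU10 : ∀ᵐ x ∂(volume : Measure (EuclideanSpace ℝ (Fin 3))), U₁ x = 0 := by
    filter_upwards [ae_all_iff.2 hcoord] with x hx
    ext i
    have h1 := hx i
    simp only [Pi.zero_apply] at h1
    rw [EuclideanSpace.inner_single_right] at h1
    simpa using h1
  -- ## (6) `u = U₀` a.e. on the past slab
  have hU' : ∀ᵐ z ∂(volume.restrict (Iio T₁ ×ˢ (univ : Set (EuclideanSpace ℝ (Fin 3))))), u z.1 z.2 = U₀ z.2 := by
    filter_upwards [hU, AffinePast.ae_slab_of_ae (T₁ := T₁) hU10] with z hz hz0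
    rw [hz, hz0, smul_zero, add_zero]
  exact AePastSteady.ae_eq_zero_of_gauge_of_aePastSteady hρ hsw hH hc hT₁ hU'

end ModulatedEuler

/-- **Binder language: STEADY FIELD + ONE `C¹`-MODULATED PATTERN OFF THE RICCATI FAMILY ⇒ TRIVIAL** — `u(τ, x) = U₀(x) + θ(τ) U₁(x)`
for a.e. `(τ, x) ∈ (−∞,T₁) × ℝ³` (`T₁ ≤ 0`, `U₀ U₁` arbitrary, `θ ∈ C¹(ℝ)`) with `θ` NOT a solution of `θ' = α + βθ + γθ²` on `(−∞,T₁)`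
for any constants ⇒ `u = 0` a.e., every `ρ > 0` (`ModulatedEuler.ae_eq_zero_of_gauge_of_aeModulatedEuler`). [folklore] -/
theorem Birth.nonSelfSimilar_of_aeModulatedEuler :
    ∀ ρ : ℝ, 0 < ρ →
      ∀ (u : ℝ → EuclideanSpace ℝ (Fin 3) → EuclideanSpace ℝ (Fin 3)) (p : ℝ → EuclideanSpace ℝ (Fin 3) → ℝ)
        (H : ℝ → EuclideanSpace ℝ (Fin 3) → EuclideanSpace ℝ (Fin 3) →L[ℝ] EuclideanSpace ℝ (Fin 3)) (c : ℝ≥0),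
        Birth.InClass ρ u p H c →
          (∃ T₁ : ℝ, T₁ ≤ 0 ∧ ∃ θ : ℝ → ℝ, ∃ U₀ U₁ : EuclideanSpace ℝ (Fin 3) → EuclideanSpace ℝ (Fin 3),
              ContDiff ℝ 1 θ ∧ (¬ ∃ α β γ : ℝ, ∀ t, t < T₁ → deriv θ t = α + β * θ t + γ * θ t ^ 2) ∧
              ∀ᵐ z ∂(volume.restrict (Iio T₁ ×ˢ (univ : Set (EuclideanSpace ℝ (Fin 3))))),
                u z.1 z.2 = U₀ z.2 + θ z.1 • U₁ z.2) →
          uncurry u =ᵐ[volume.restrict (Iio (0 : ℝ) ×ˢ (univ : Set (EuclideanSpace ℝ (Fin 3))))] 0 := by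
  intro ρ hρ u p H c hcl h
  obtain ⟨T₁, hT₁, θ, U₀, U₁, hθ1, hric, hU⟩ := h
  exact ModulatedEuler.ae_eq_zero_of_gauge_of_aeModulatedEuler hρ hcl.1 hcl.2.1 hcl.2.2 hT₁ hθ1 hric hU

end Summit.NavierStokesRegularity.NavierStokesRegularity.Theorems.PowerGaugeEulerLiouville

end
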